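import Summits.ResolutionOfSingularities.ResolutionOfSingularities.Theorems.PurelyInseparableDim4ValueCert
import HarnessLib
import HarnessLib.Audit.Tags

/-!
# Purely inseparable fourfolds — VALUE CERTIFICATES: the LEAFLESS loss-row checker
# [OURS · counted 0 · a certificate format for OUR frame, not about resolution]

Census cell «res-dim4-pi» (D-0157 DOOR 2), width seat `res-dim4-p-6` (g6).  Sequel of `PurelyInseparableDim4ValueCert`
(`lrowOK`, `not_resWinsIn_of_lrowOK`).  In a B-table of depth `d ≥ 1` most rows are the DEPTH-0 LEAVES: children that only
have to be «not won within 0 moves», i.e. whose origin is still `q`-fold — and `lchildStep` already checks exactly that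
(`permB q univ c`, the equimultiplicity of B's answer).  The leafless checker drops the table lookup for such children:

* `lchildStep0 q T d c := permB q univ c && !(equivB c []) && (d = 0 || lchildOK T c d)`, `lreplyOK0`, `lrowOK0` —
  `lrowOK` with the lookup required only when the child must survive `d ≥ 1` further rounds;
* **`not_resWinsIn_of_lrowOK0`** — the same soundness statement as `not_resWinsIn_of_lrowOK` (induction on the budget; at
  budget `1` the child's `q`-fold origin is the whole argument), and `exists_answer_not_win_of_lreplyOK0` (root-centre
  reading); `lrowOK0_smallLoss0` — the model `x₃x₄ + x₂²x₃x₄` of the format file needs ONE row instead of five.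

Tables shrink 3–5× (the located objects of value 5–6 have B-tables of ~10³ rows with leaves, ~3·10² without).
CAVEAT: `K`-rational answers over the finite `K` of the certificate only; a LOSS table is a LOWER BOUND on `ρ` inside the
`K`-rational game — NOT a B-win, NOT `¬ StateWins`, never summed with ∀K counts (desk WORD #243 (b1)); statements about
OUR frame's game; nothing here proves F4-C in any form or resolution of singularities in dimension ≥ 4 / characteristic
`p`; counted 0; AI kernel work, weaker than expert review.
bears_on: LADDER-RESOLUTION:D157-DOOR2 (res-dim4-pi · value-certificate format, leafless loss rows). Supports
stmt-ResolutionOfSingularities-16155 (helper).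
-/

set_option linter.dupNamespace false

noncomputable section

namespace Summit.ResolutionOfSingularities.ResolutionOfSingularities.Theorems.PIDim4

namespace ValueCert

open MvPolynomial Finset
open Literature.AlgebraicGeometry.Resolution
open Literature.AlgebraicGeometry.Resolution.CentreBlowup
open StepKit WinCertSound InScopeWinCert LoopCLocal

variable {K : Type} [Field K] [DecidableEq K]

/-- The compact child `c` is a legal landing for B that survives `d` more rounds, LEAFLESS form: origin `q`-fold,
non-zero, and — only when `d ≥ 1` — a loss row of depth `≥ d`. [folklore] -/
def lchildStep0 (q : ℕ) (T : List (LRow K)) (d : ℕ) (c : Terms 4 K) : Bool :=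
  permB q Finset.univ c && !(StepKit.equivB c []) && (decide (d = 0) || lchildOK T c d)

/-- B's table entry `(j, b)` answers the centre `S` at `L` inside the class `β` and survives `d` more rounds (leafless).
[folklore] -/
def lreplyOK0 (q : ℕ) (β : Finset (Fin 4) → Fin 4 → (Fin 4 → K) → Bool) (T : List (LRow K)) (L : Terms 4 K)
    (d : ℕ) (S : Finset (Fin 4)) (jb : Fin 4 × (Fin 4 → K)) : Bool :=
  decide (jb.1 ∈ S) && decide (jb.2 jb.1 = 0) && β S jb.1 jb.2 &&
    lchildStep0 q T d (compactL (stepD q S jb.1 jb.2 (sd L)).L)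

/-- **Leafless loss-row check**: the origin is `q`-fold and, if `d ≥ 1`, EVERY permissible centre has a table answer
surviving `d − 1` more rounds (a row is cited only when `d − 1 ≥ 1`). [folklore] -/
def lrowOK0 (q : ℕ) (β : Finset (Fin 4) → Fin 4 → (Fin 4 → K) → Bool) (T : List (LRow K)) (row : LRow K) : Bool :=
  permB q Finset.univ row.1 &&
    (decide (row.2.1 = 0) ||
      decide (∀ S : Finset (Fin 4), permB q S row.1 = true →
        (row.2.2.any fun e => decide (e.1 = S) && lreplyOK0 q β T row.1 (row.2.1 - 1) S e.2) = true))

/-- A leafless table entry names a `β`-answer to `S` whose child has a `q`-fold origin (so the answer is an equimultiple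
point), is non-zero, and is a loss row of depth `≥ d` unless `d = 0`. [folklore] -/
theorem exists_answer_of_lreplyOK0 {q : ℕ} {β : Finset (Fin 4) → Fin 4 → (Fin 4 → K) → Bool} {T : List (LRow K)}
    {L : Terms 4 K} {d : ℕ} {S : Finset (Fin 4)} {jb : Fin 4 × (Fin 4 → K)} (h : lreplyOK0 q β T L d S jb = true)
    {s : State K} (hs : s.F = evalT L) :
    ∃ s', RSucc q β s S s' ∧ IsPermissibleCentre q Finset.univ s'.F ∧
      (d = 0 ∨ ∃ r ∈ T, d ≤ r.2.1 ∧ s'.F = evalT r.1) := by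
  unfold lreplyOK0 lchildStep0 at h
  simp only [Bool.and_eq_true, decide_eq_true_eq, Bool.not_eq_true', Bool.or_eq_true] at h
  obtain ⟨⟨⟨hj, hbj⟩, hβ⟩, ⟨hpc, hnz⟩, hchild⟩ := h
  have hF := step_F_eq_compact_child q S jb.1 jb.2 hs
  have hperm : IsPermissibleCentre q Finset.univ (step q S jb.1 jb.2 s).F := by
    rw [hF]; exact (isPermissibleCentre_iff q _ _).mpr hpc
  have heq : IsEquimultiplePoint q S jb.1 jb.2 s :=
    (isEquimultiplePoint_iff_isPermissibleCentre_univ_step q S jb.1 jb.2 s).mpr hperm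
  have hne : (step q S jb.1 jb.2 s).F ≠ 0 := by
    rw [hF, Ne, evalT_eq_zero_iff, hnz]
    exact Bool.false_ne_true
  refine ⟨step q S jb.1 jb.2 s, ⟨jb.1, jb.2, hj, hbj, hβ, heq, hne, rfl⟩, hperm, ?_⟩
  rcases hchild with h0 | hlook
  · exact Or.inl h0
  · unfold lchildOK at hlook
    obtain ⟨r, hr, hrc⟩ := List.any_eq_true.mp hlook
    rw [Bool.and_eq_true, decide_eq_true_eq, Bool.and_eq_true] at hrc
    refine Or.inr ⟨r, hr, hrc.1, ?_⟩
    rw [hF]; exact (evalT_eq_iff_equivB _ _).mpr hrc.2.2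

/-- **SOUNDNESS OF LEAFLESS LOSS ROWS** (same statement as `not_resWinsIn_of_lrowOK`). [folklore] -/
theorem not_resWinsIn_of_lrowOK0 {q : ℕ} {β : Finset (Fin 4) → Fin 4 → (Fin 4 → K) → Bool} {T : List (LRow K)}
    (hT : ∀ row ∈ T, lrowOK0 q β T row = true) :
    ∀ row ∈ T, ∀ s : State K, s.F = evalT row.1 → ¬ ResWinsIn q β row.2.1 s := by
  suffices key : ∀ n : ℕ, ∀ row ∈ T, n ≤ row.2.1 → ∀ s : State K, s.F = evalT row.1 → ¬ ResWinsIn q β n s from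
    fun row hrow => key _ row hrow le_rfl
  intro n
  induction n with
  | zero =>
    intro row hrow _ s hs
    have h := hT row hrow
    unfold lrowOK0 at h
    rw [Bool.and_eq_true] at h
    exact Game.not_winsIn_zero (exists_permissible_of_permB_true hs h.1)
  | succ k ih =>
    intro row hrow hk s hs
    have h := hT row hrow
    unfold lrowOK0 at h
    rw [Bool.and_eq_true, Bool.or_eq_true, decide_eq_true_eq, decide_eq_true_eq] at h
    obtain ⟨hperm, htab⟩ := h
    rcases htab with h0 | htab
    · omega
    refine Game.not_winsIn_succ (exists_permissible_of_permB_true hs hperm) fun S hS => ?_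
    have hS' : permB q S row.1 = true := by rw [hs] at hS; exact (isPermissibleCentre_iff q S row.1).mp hS
    obtain ⟨e, -, he⟩ := List.any_eq_true.mp (htab S hS')
    rw [Bool.and_eq_true, decide_eq_true_eq] at he
    obtain ⟨rfl, he⟩ := he
    obtain ⟨s', hs', hperm', hcases⟩ := exists_answer_of_lreplyOK0 he hs
    refine ⟨s', hs', ?_⟩
    rcases hcases with h0 | ⟨r, hr, hdr, hrF⟩
    · -- budget k = 0 left for A at the child: its origin is q-fold, so it is not won within 0 moves
      have hk0 : k = 0 := by omega
      subst hk0
      exact Game.not_winsIn_zero ⟨Finset.univ, hperm'⟩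
    · exact ih r hr (by omega) _ hrF

/-- **Root-centre reading, B's side (leafless)**: a table entry passing `lreplyOK0 q β T L d S` against a sound leafless
loss table `T` names a `β`-answer to `S` from which A does not win within `d`. [folklore] -/
theorem exists_answer_not_win_of_lreplyOK0 {q : ℕ} {β : Finset (Fin 4) → Fin 4 → (Fin 4 → K) → Bool}
    {T : List (LRow K)} (hT : ∀ row ∈ T, lrowOK0 q β T row = true) {L : Terms 4 K} {d : ℕ} {S : Finset (Fin 4)}
    {jb : Fin 4 × (Fin 4 → K)} (h : lreplyOK0 q β T L d S jb = true) {s : State K} (hs : s.F = evalT L) :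
    ∃ s', RSucc q β s S s' ∧ ¬ ResWinsIn q β d s' := by
  obtain ⟨s', hs', hperm', hcases⟩ := exists_answer_of_lreplyOK0 h hs
  refine ⟨s', hs', ?_⟩
  rcases hcases with rfl | ⟨r, hr, hdr, hrF⟩
  · exact Game.not_winsIn_zero ⟨Finset.univ, hperm'⟩
  · exact fun hw => not_resWinsIn_of_lrowOK0 hT r hr _ hrF (hw.mono hdr)

/-! ## Model: the format file's `x₃x₄ + x₂²x₃x₄` with a one-row loss table -/

/-- Leafless loss table for `x₃x₄ + x₂²x₃x₄` at depth 1 (the four children are checked `2`-fold in place).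
[folklore] -/
def smallLoss0 : List (LRow (ZMod 2)) :=
  [([(![0, 0, 1, 1], 1), (![0, 2, 1, 1], 1)], 1,
      [({2, 3}, 2, ![0, 1, 0, 0]), ({0, 2, 3}, 0, ![0, 0, 0, 0]), ({1, 2, 3}, 1, ![0, 0, 0, 0]),
       ({0, 1, 2, 3}, 0, ![0, 0, 0, 0])])]

/-- It passes. [folklore] -/
theorem lrowOK0_smallLoss0 : ∀ row ∈ smallLoss0, lrowOK0 2 (fun _ _ _ => true) smallLoss0 row = true := by
  decide

/-- Hence (again) `x₃x₄ + x₂²x₃x₄` is not won within 1 move in the TRAVEL game over `𝔽₂`. [OURS · ‖ K] [folklore] -/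
theorem not_win_one_small (s : State (ZMod 2)) (hs : s.F = evalT [(![0, 0, 1, 1], 1), (![0, 2, 1, 1], 1)]) :
    ¬ ResWinsIn 2 (fun _ _ _ => true) 1 s :=
  not_resWinsIn_of_lrowOK0 lrowOK0_smallLoss0 _ List.mem_cons_self s hs

end ValueCert

end Summit.ResolutionOfSingularities.ResolutionOfSingularities.Theorems.PIDim4

end
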